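import Mathlib.Probability.Kernel.Basic
import Mathlib.Probability.Kernel.MeasurableIntegral
import Mathlib.MeasureTheory.Integral.IntervalIntegral.Basic
import Mathlib.Analysis.SpecialFunctions.Integrals.Basic
import Mathlib.Analysis.SpecificLimits.Normed
import Mathlib.Topology.Algebra.Order.Floor
import Mathlib.Topology.ContinuousMap.Bounded.Basic
import HarnessLib

/-!
# Route `ColdStartUniversality`, crux K_A1 `UniformColdStartMixing` (stmt-QuantumFields-24809), rung `stub_fixedCutoffMixing`:
# (Inv) wall, step F — the Picard/Grönwall argument, abstractly

Helper file (seat `ym-line-csu-p1`, g8).  ABSTRACT measure theory, no SZZ object.  Data: a compact space `X` with a finite measure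
`π`, two Markov kernel families `κ_t` (the dynamics) and `κ⁰_t` (the reference dynamics), continuous functions `ρ ≥ 0` (weight),
`φ > 0` (ground state), `V̂` (potential), and a class `E` of continuous functions which is uniformly dense, closed under products
and under the reference kernels.  Write `m_s(h) := ∫ (κ_s h) ρ dπ`, `m₀(h) := ∫ h ρ dπ`, `T_r w := κ⁰_r w`.  HYPOTHESIS (the
integrated Duhamel identity, supplied for the SZZ system by steps A–C):

  `m_t(φ w) - m₀(φ w) = ∫₀ᵗ [m₀(φ V̂ T_r w) - m_{t-r}(φ V̂ T_r w)] dr`   for `w ∈ E`.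

CONCLUSION (`integral_kernel_weighted_eq_of_duhamel`): `m_t(h) = m₀(h)` for every continuous `h` and every `t`, i.e. the measure
`ρ π` is invariant under `κ_t` on continuous observables.  Proof: Picard iteration of the identity — approximating `V̂` uniformly
by elements of `E` inside the induction — gives `|m_t(φw) - m₀(φw)| ≤ C ‖w‖ (Kt)ⁿ/n!` for all `n`, hence `0`; then density of
`φ·E`.  No definition, no sorry.  RECORD-rung R3 plumbing; nothing here bears on the Yang–Mills mass gap.
-/

set_option autoImplicit false

noncomputable section

namespace Summit.QuantumFields.YangMills.Theorems.ColdStartUniversality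

open MeasureTheory ProbabilityTheory Filter Topology Set
open scoped NNReal

/-- **Invariance from the integrated Duhamel identity (Picard/Grönwall).**  See the module docstring. [folklore] -/
theorem integral_kernel_weighted_eq_of_duhamel
    {X : Type*} [TopologicalSpace X] [CompactSpace X] [MeasurableSpace X] [BorelSpace X]
    (π : Measure X) [IsFiniteMeasure π]
    (κ κ₀ : ℝ≥0 → Kernel X X) [∀ t, IsMarkovKernel (κ t)] [∀ t, IsMarkovKernel (κ₀ t)]
    {ρ φ Vh : X → ℝ} (hρc : Continuous ρ) (hρ0 : ∀ x, 0 ≤ ρ x) (hφc : Continuous φ) (hφpos : ∀ x, 0 < φ x)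
    (hVc : Continuous Vh)
    (E : Set (X → ℝ)) (hEc : ∀ w ∈ E, Continuous w) (hEmul : ∀ w ∈ E, ∀ w' ∈ E, (fun x => w x * w' x) ∈ E)
    (hET : ∀ w ∈ E, ∀ r : ℝ≥0, (fun x => ∫ y, w y ∂(κ₀ r x)) ∈ E)
    (hEd : ∀ G : X → ℝ, Continuous G → ∀ ε : ℝ, 0 < ε → ∃ w ∈ E, ∀ x, |w x - G x| < ε)
    (h5 : ∀ w ∈ E, ∀ t : ℝ≥0,
      (∫ x, (∫ y, φ y * w y ∂(κ t x)) * ρ x ∂π) - ∫ x, φ x * w x * ρ x ∂π =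
        ∫ r in (0 : ℝ)..(t : ℝ),
          ((∫ x, φ x * Vh x * (∫ y, w y ∂(κ₀ r.toNNReal x)) * ρ x ∂π) -
            ∫ x, (∫ y, φ y * Vh y * (∫ z, w z ∂(κ₀ r.toNNReal y)) ∂(κ ((t : ℝ) - r).toNNReal x)) * ρ x ∂π)) :
    ∀ (t : ℝ≥0) (h : X → ℝ), Continuous h → ∫ x, (∫ y, h y ∂(κ t x)) * ρ x ∂π = ∫ x, h x * ρ x ∂π := by
  classical
  -- ### bounds of continuous functions on the compact space
  have hbdd : ∀ f : X → ℝ, Continuous f → ∃ M : ℝ, 0 ≤ M ∧ ∀ x, |f x| ≤ M := fun f hf => by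
    obtain ⟨M, hM⟩ := isCompact_univ.bddAbove_image (continuous_abs.comp hf).continuousOn
    exact ⟨max M 0, le_max_right _ _, fun x => (hM ⟨x, mem_univ _, rfl⟩).trans (le_max_left _ _)⟩
  obtain ⟨Φ, hΦ0, hΦ⟩ := hbdd φ hφc
  obtain ⟨KV, hKV0, hKV⟩ := hbdd Vh hVc
  obtain ⟨Mρ, hMρ0, hMρ⟩ := hbdd ρ hρc
  set Z : ℝ := ∫ x, ρ x ∂π with hZ
  have hZ0 : 0 ≤ Z := integral_nonneg hρ0
  -- ### kernel averages: measurability, bounds, continuity is not needed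
  have hker_sm : ∀ (η : Kernel X X) {f : X → ℝ}, Continuous f → StronglyMeasurable fun x => ∫ y, f y ∂(η x) :=
    fun η f hf => hf.stronglyMeasurable.integral_kernel
  have hker_bd : ∀ (η : Kernel X X) [IsMarkovKernel η] {f : X → ℝ} {Mf : ℝ}, (∀ y, |f y| ≤ Mf) →
      ∀ x, |∫ y, f y ∂(η x)| ≤ Mf := by
    intro η _ f Mf hf x
    have h := norm_integral_le_of_norm_le_const (μ := η x) (f := f) (C := Mf)
      (Eventually.of_forall fun y => by rw [Real.norm_eq_abs]; exact hf y)
    rwa [Real.norm_eq_abs, probReal_univ, mul_one] at h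
  have hintκ : ∀ (η : Kernel X X) [IsMarkovKernel η] {f : X → ℝ}, Continuous f → ∀ x, Integrable f (η x) := by
    intro η _ f hf x
    obtain ⟨Mf, -, hMf⟩ := hbdd f hf
    exact Integrable.of_bound hf.stronglyMeasurable.aestronglyMeasurable Mf
      (Eventually.of_forall fun y => by rw [Real.norm_eq_abs]; exact hMf y)
  have hintπ : ∀ (η : Kernel X X) [IsMarkovKernel η] {f : X → ℝ}, Continuous f →
      Integrable (fun x => (∫ y, f y ∂(η x)) * ρ x) π := by
    intro η _ f hf
    obtain ⟨Mf, -, hMf⟩ := hbdd f hf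
    refine Integrable.of_bound ((hker_sm η hf).mul hρc.stronglyMeasurable).aestronglyMeasurable (Mf * Mρ)
      (Eventually.of_forall fun x => ?_)
    rw [Real.norm_eq_abs, abs_mul]
    exact mul_le_mul (hker_bd η hMf x) (hMρ x) (abs_nonneg _) ((abs_nonneg _).trans (hker_bd η hMf x))
  have hintπ₀ : ∀ {f : X → ℝ}, Continuous f → Integrable (fun x => f x * ρ x) π := by
    intro f hf
    obtain ⟨Mf, -, hMf⟩ := hbdd f hf
    refine Integrable.of_bound (hf.mul hρc).stronglyMeasurable.aestronglyMeasurable (Mf * Mρ)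
      (Eventually.of_forall fun x => ?_)
    rw [Real.norm_eq_abs, abs_mul]
    exact mul_le_mul (hMf x) (hMρ x) (abs_nonneg _) ((abs_nonneg _).trans (hMf x))
  -- ### the pairings `m_s(h) = ∫ (κ_s h) ρ dπ`, `m₀(h) = ∫ h ρ dπ`: bounds and additivity
  have hm_bd : ∀ (s : ℝ≥0) {f : X → ℝ} {Mf : ℝ}, Continuous f → (∀ y, |f y| ≤ Mf) →
      |∫ x, (∫ y, f y ∂(κ s x)) * ρ x ∂π| ≤ Z * Mf := by
    intro s f Mf hf hMf
    refine (abs_integral_le_integral_abs).trans ?_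
    calc ∫ x, |(∫ y, f y ∂(κ s x)) * ρ x| ∂π ≤ ∫ x, Mf * ρ x ∂π := by
          refine integral_mono (hintπ (κ s) hf).abs ((hintπ₀ continuous_const)) fun x => ?_
          dsimp only
          rw [abs_mul, abs_of_nonneg (hρ0 x)]
          exact mul_le_mul_of_nonneg_right (hker_bd (κ s) hMf x) (hρ0 x)
      _ = Z * Mf := by rw [integral_const_mul, hZ, mul_comm]
  have hm₀_bd : ∀ {f : X → ℝ} {Mf : ℝ}, Continuous f → (∀ y, |f y| ≤ Mf) → |∫ x, f x * ρ x ∂π| ≤ Z * Mf := by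
    intro f Mf hf hMf
    refine (abs_integral_le_integral_abs).trans ?_
    calc ∫ x, |f x * ρ x| ∂π ≤ ∫ x, Mf * ρ x ∂π := by
          refine integral_mono (hintπ₀ hf).abs (hintπ₀ continuous_const) fun x => ?_
          dsimp only
          rw [abs_mul, abs_of_nonneg (hρ0 x)]
          exact mul_le_mul_of_nonneg_right (hMf x) (hρ0 x)
      _ = Z * Mf := by rw [integral_const_mul, hZ, mul_comm]
  have hm_add : ∀ (s : ℝ≥0) {f₁ f₂ : X → ℝ}, Continuous f₁ → Continuous f₂ →
      ∫ x, (∫ y, (f₁ y + f₂ y) ∂(κ s x)) * ρ x ∂π =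
        (∫ x, (∫ y, f₁ y ∂(κ s x)) * ρ x ∂π) + ∫ x, (∫ y, f₂ y ∂(κ s x)) * ρ x ∂π := by
    intro s f₁ f₂ hf₁ hf₂
    rw [← integral_add (hintπ (κ s) hf₁) (hintπ (κ s) hf₂)]
    refine integral_congr_ae (Eventually.of_forall fun x => ?_)
    dsimp only
    rw [integral_add (hintκ (κ s) hf₁ x) (hintκ (κ s) hf₂ x), add_mul]
  have hm₀_add : ∀ {f₁ f₂ : X → ℝ}, Continuous f₁ → Continuous f₂ →
      ∫ x, (f₁ x + f₂ x) * ρ x ∂π = (∫ x, f₁ x * ρ x ∂π) + ∫ x, f₂ x * ρ x ∂π := by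
    intro f₁ f₂ hf₁ hf₂
    rw [← integral_add (hintπ₀ hf₁) (hintπ₀ hf₂)]
    exact integral_congr_ae (Eventually.of_forall fun x => by dsimp only; rw [add_mul])
  -- continuity of kernel averages of `E`-functions (they lie in `E`)
  have hTc : ∀ w ∈ E, ∀ r : ℝ≥0, Continuous fun x => ∫ y, w y ∂(κ₀ r x) := fun w hw r => hEc _ (hET w hw r)
  -- ### the Picard iteration
  set C : ℝ := 2 * Z * Φ with hC
  set K : ℝ := KV + 1 with hK
  have hC0 : 0 ≤ C := by rw [hC]; positivity
  have hK0 : 0 ≤ K := by rw [hK]; linarith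
  have hP : ∀ n : ℕ, ∀ w ∈ E, ∀ M : ℝ, 0 ≤ M → (∀ x, |w x| ≤ M) → ∀ t : ℝ≥0,
      |(∫ x, (∫ y, φ y * w y ∂(κ t x)) * ρ x ∂π) - ∫ x, φ x * w x * ρ x ∂π| ≤ C * M * (K * t) ^ n / n.factorial := by
    intro n
    induction n with
    | zero =>
      intro w hw M hM0 hwM t
      have hwc := hEc w hw
      have hφw : ∀ y, |φ y * w y| ≤ Φ * M := fun y => by
        rw [abs_mul]; exact mul_le_mul (hΦ y) (hwM y) (abs_nonneg _) hΦ0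
      have h1 := hm_bd t (hφc.mul hwc) hφw
      have h2 : |∫ x, φ x * w x * ρ x ∂π| ≤ Z * (Φ * M) := hm₀_bd (hφc.mul hwc) hφw
      rw [pow_zero, Nat.factorial_zero, Nat.cast_one, div_one, mul_one]
      calc |(∫ x, (∫ y, φ y * w y ∂(κ t x)) * ρ x ∂π) - ∫ x, φ x * w x * ρ x ∂π|
          ≤ |∫ x, (∫ y, φ y * w y ∂(κ t x)) * ρ x ∂π| + |∫ x, φ x * w x * ρ x ∂π| := abs_sub _ _
        _ ≤ Z * (Φ * M) + Z * (Φ * M) := add_le_add h1 h2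
        _ = C * M := by rw [hC]; ring
    | succ n ih =>
      intro w hw M hM0 hwM t
      have hwc := hEc w hw
      -- bound for every `ε ∈ (0,1]`
      have hε : ∀ ε : ℝ, 0 < ε → ε ≤ 1 →
          |(∫ x, (∫ y, φ y * w y ∂(κ t x)) * ρ x ∂π) - ∫ x, φ x * w x * ρ x ∂π| ≤
            C * M * (K * t) ^ (n + 1) / (n + 1).factorial + 2 * Z * Φ * M * t * ε := by
        intro ε hε0 hε1
        obtain ⟨Vt, hVt, hVtε⟩ := hEd Vh hVc ε hε0
        have hVtc := hEc Vt hVt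
        have hVtb : ∀ y, |Vt y| ≤ K := fun y => by
          have h1 : |Vt y| ≤ |Vh y| + |Vt y - Vh y| := by
            have := abs_add_le (Vh y) (Vt y - Vh y); rwa [add_sub_cancel] at this
          rw [hK]; linarith [hKV y, (hVtε y).le]
        have hVd : ∀ y, |Vh y - Vt y| ≤ ε := fun y => by rw [abs_sub_comm]; exact (hVtε y).le
        -- the test functions along the Duhamel integral
        set T : ℝ → X → ℝ := fun r y => ∫ z, w z ∂(κ₀ r.toNNReal y) with hT
        have hTE : ∀ r, T r ∈ E := fun r => hET w hw r.toNNReal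
        have hTcr : ∀ r, Continuous (T r) := fun r => hEc _ (hTE r)
        have hTb : ∀ r y, |T r y| ≤ M := fun r y => hker_bd (κ₀ r.toNNReal) hwM y
        have hw'E : ∀ r, (fun y => Vt y * T r y) ∈ E := fun r => hEmul Vt hVt (T r) (hTE r)
        have hw'b : ∀ r y, |Vt y * T r y| ≤ K * M := fun r y => by
          rw [abs_mul]; exact mul_le_mul (hVtb y) (hTb r y) (abs_nonneg _) hK0
        -- the integrand of the Duhamel integral and its bound on `[0, t]`
        set F : ℝ → ℝ := fun r =>
          (∫ x, φ x * Vh x * T r x * ρ x ∂π) -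
            ∫ x, (∫ y, φ y * Vh y * T r y ∂(κ ((t : ℝ) - r).toNNReal x)) * ρ x ∂π with hF
        set A : ℝ := C * (K * M) * K ^ n / n.factorial with hA
        set D : ℝ := 2 * (Z * (Φ * ε * M)) with hD
        set B : ℝ → ℝ := fun r => A * ((t : ℝ) - r) ^ n + D with hB
        have hFB : ∀ r ∈ Icc (0 : ℝ) t, |F r| ≤ B r := by
          intro r hr
          have htr : (((t : ℝ) - r).toNNReal : ℝ) = (t : ℝ) - r := Real.coe_toNNReal _ (sub_nonneg.2 hr.2)
          -- split `φ V̂ T = φ (Vt T) + φ (V̂ - Vt) T`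
          have hc1 : Continuous fun y => φ y * (Vt y * T r y) := hφc.mul (hVtc.mul (hTcr r))
          have hc2 : Continuous fun y => φ y * (Vh y - Vt y) * T r y := (hφc.mul (hVc.sub hVtc)).mul (hTcr r)
          have hb2 : ∀ y, |φ y * (Vh y - Vt y) * T r y| ≤ Φ * ε * M := fun y => by
            rw [abs_mul, abs_mul]
            exact mul_le_mul (mul_le_mul (hΦ y) (hVd y) (abs_nonneg _) hΦ0) (hTb r y) (abs_nonneg _) (by positivity)
          have hea : ∫ x, φ x * Vh x * T r x * ρ x ∂π =
              ∫ x, (φ x * (Vt x * T r x) + φ x * (Vh x - Vt x) * T r x) * ρ x ∂π :=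
            integral_congr_ae (Eventually.of_forall fun x => by ring)
          have heb : ∫ x, (∫ y, φ y * Vh y * T r y ∂(κ ((t : ℝ) - r).toNNReal x)) * ρ x ∂π =
              ∫ x, (∫ y, (φ y * (Vt y * T r y) + φ y * (Vh y - Vt y) * T r y) ∂(κ ((t : ℝ) - r).toNNReal x)) * ρ x ∂π := by
            refine integral_congr_ae (Eventually.of_forall fun x => ?_)
            dsimp only
            congr 1
            exact integral_congr_ae (Eventually.of_forall fun y => by ring)
          have hF' : F r = ((∫ x, φ x * (Vt x * T r x) * ρ x ∂π) -
              ∫ x, (∫ y, φ y * (Vt y * T r y) ∂(κ ((t : ℝ) - r).toNNReal x)) * ρ x ∂π) +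
              ((∫ x, φ x * (Vh x - Vt x) * T r x * ρ x ∂π) -
                ∫ x, (∫ y, φ y * (Vh y - Vt y) * T r y ∂(κ ((t : ℝ) - r).toNNReal x)) * ρ x ∂π) := by
            rw [hF]
            dsimp only
            rw [hea, heb, hm₀_add hc1 hc2, hm_add _ hc1 hc2]
            ring
          rw [hF']
          have hih := ih (fun y => Vt y * T r y) (hw'E r) (K * M) (by positivity) (hw'b r) (((t : ℝ) - r).toNNReal)
          rw [htr] at hih
          have h3 := hm₀_bd hc2 hb2
          have h4 := hm_bd (((t : ℝ) - r).toNNReal) hc2 hb2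
          calc _ ≤ |(∫ x, φ x * (Vt x * T r x) * ρ x ∂π) -
                ∫ x, (∫ y, φ y * (Vt y * T r y) ∂(κ ((t : ℝ) - r).toNNReal x)) * ρ x ∂π| +
              |(∫ x, φ x * (Vh x - Vt x) * T r x * ρ x ∂π) -
                ∫ x, (∫ y, φ y * (Vh y - Vt y) * T r y ∂(κ ((t : ℝ) - r).toNNReal x)) * ρ x ∂π| := abs_add_le _ _
            _ ≤ C * (K * M) * (K * ((t : ℝ) - r)) ^ n / n.factorial + (Z * (Φ * ε * M) + Z * (Φ * ε * M)) := by
              refine add_le_add ?_ ((abs_sub _ _).trans (add_le_add h3 h4))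
              rw [abs_sub_comm]; exact hih
            _ = B r := by rw [hB, hA, hD]; dsimp only; rw [mul_pow]; ring
        -- the Duhamel identity and the integral bound
        have h5w := h5 w hw t
        have hAc : Continuous fun r : ℝ => A * ((t : ℝ) - r) ^ n :=
          continuous_const.mul ((continuous_const.sub continuous_id).pow n)
        have hBc : Continuous B := by rw [hB]; exact hAc.add continuous_const
        have hBi : IntervalIntegrable B volume 0 t := hBc.intervalIntegrable _ _
        have ht0 : (0 : ℝ) ≤ t := t.2
        have hIB : |∫ r in (0 : ℝ)..t, F r| ≤ ∫ r in (0 : ℝ)..t, B r := by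
          by_cases hFi : IntervalIntegrable F volume 0 t
          · calc |∫ r in (0 : ℝ)..t, F r| ≤ ∫ r in (0 : ℝ)..t, |F r| :=
                  intervalIntegral.abs_integral_le_integral_abs ht0
              _ ≤ ∫ r in (0 : ℝ)..t, B r :=
                  intervalIntegral.integral_mono_on ht0 hFi.abs hBi fun r hr => hFB r hr
          · rw [intervalIntegral.integral_undef hFi, abs_zero]
            exact intervalIntegral.integral_nonneg ht0 fun r hr => (abs_nonneg _).trans (hFB r hr)
        -- evaluate `∫₀ᵗ B`
        have hIBval : ∫ r in (0 : ℝ)..t, B r =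
            C * M * (K * t) ^ (n + 1) / (n + 1).factorial + 2 * Z * Φ * M * t * ε := by
          have hpow : ∫ r in (0 : ℝ)..t, ((t : ℝ) - r) ^ n = (t : ℝ) ^ (n + 1) / (n + 1) := by
            have h := intervalIntegral.integral_comp_sub_left (fun u : ℝ => u ^ n) (t : ℝ) (a := 0) (b := t)
            simp only [sub_self, sub_zero] at h
            rw [h, integral_pow]
            simp
          rw [hB, intervalIntegral.integral_add (hAc.intervalIntegrable _ _) (continuous_const.intervalIntegrable _ _),
            intervalIntegral.integral_const_mul, hpow, intervalIntegral.integral_const, smul_eq_mul, sub_zero, hA, hD,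
            Nat.factorial_succ, Nat.cast_mul, Nat.cast_add, Nat.cast_one]
          have hn : (n.factorial : ℝ) ≠ 0 := by positivity
          have hn1 : ((n : ℝ) + 1) ≠ 0 := by positivity
          field_simp
          ring
        rw [h5w]
        calc |∫ r in (0 : ℝ)..t, F r| ≤ ∫ r in (0 : ℝ)..t, B r := hIB
          _ = _ := hIBval
      -- let `ε → 0`
      refine le_of_forall_pos_le_add fun δ hδ => ?_
      by_cases hzero : 2 * Z * Φ * M * t = 0
      · have h := hε 1 one_pos le_rfl
        rw [hzero, zero_mul, add_zero] at h
        linarith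
      · have hpos : 0 < 2 * Z * Φ * M * t := by
          have : 0 ≤ 2 * Z * Φ * M * t := by positivity
          exact lt_of_le_of_ne this (Ne.symm hzero)
        have h := hε (min 1 (δ / (2 * Z * Φ * M * t))) (lt_min one_pos (div_pos hδ hpos)) (min_le_left _ _)
        have h' : 2 * Z * Φ * M * t * min 1 (δ / (2 * Z * Φ * M * t)) ≤ δ :=
          calc 2 * Z * Φ * M * t * min 1 (δ / (2 * Z * Φ * M * t)) ≤ 2 * Z * Φ * M * t * (δ / (2 * Z * Φ * M * t)) :=
                mul_le_mul_of_nonneg_left (min_le_right _ _) hpos.le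
            _ = δ := by rw [← mul_div_assoc]; exact mul_div_cancel_left₀ δ hpos.ne'
        linarith
  -- ### `n → ∞`: equality on `φ·E`
  have hEq : ∀ w ∈ E, ∀ t : ℝ≥0,
      ∫ x, (∫ y, φ y * w y ∂(κ t x)) * ρ x ∂π = ∫ x, φ x * w x * ρ x ∂π := by
    intro w hw t
    obtain ⟨M, hM0, hM⟩ := hbdd w (hEc w hw)
    have hlim : Tendsto (fun n : ℕ => C * M * (K * t) ^ n / n.factorial) atTop (𝓝 0) := by
      have h := (FloorSemiring.tendsto_pow_div_factorial_atTop (K * (t : ℝ))).const_mul (C * M)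
      rw [mul_zero] at h
      refine h.congr fun n => ?_
      ring
    have hle : |(∫ x, (∫ y, φ y * w y ∂(κ t x)) * ρ x ∂π) - ∫ x, φ x * w x * ρ x ∂π| ≤ 0 :=
      ge_of_tendsto' hlim fun n => hP n w hw M hM0 hM t
    exact sub_eq_zero.1 (abs_eq_zero.1 (le_antisymm hle (abs_nonneg _)))
  -- ### density of `φ·E`
  intro t h hh
  obtain ⟨φmin, hφmin, hφmin'⟩ : ∃ c : ℝ, 0 < c ∧ ∀ x, c ≤ φ x := by
    rcases isEmpty_or_nonempty X with hX | hX
    · exact ⟨1, one_pos, fun x => (IsEmpty.false x).elim⟩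
    · obtain ⟨x₀, -, hx₀⟩ := isCompact_univ.exists_isMinOn univ_nonempty hφc.continuousOn
      exact ⟨φ x₀, hφpos x₀, fun x => hx₀ (mem_univ x)⟩
  have hgc : Continuous fun x => h x / φ x := hh.div hφc fun x => (hφpos x).ne'
  refine sub_eq_zero.1 (abs_eq_zero.1 (le_antisymm (le_of_forall_pos_le_add fun δ hδ => ?_) (abs_nonneg _)))
  have hZΦ : 0 < Z * Φ + 1 := by positivity
  obtain ⟨w, hw, hwε⟩ := hEd _ hgc (δ / (2 * (Z * Φ + 1))) (by positivity)
  have hwc := hEc w hw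
  -- `h = φ w + (h - φ w)` with `|h - φ w| ≤ Φ ε`
  have hsplit : (fun y => h y) = fun y => φ y * w y + (h y - φ y * w y) := by funext y; ring
  have hdc : Continuous fun y => h y - φ y * w y := hh.sub (hφc.mul hwc)
  have hdb : ∀ y, |h y - φ y * w y| ≤ Φ * (δ / (2 * (Z * Φ + 1))) := fun y => by
    have h1 : h y - φ y * w y = φ y * (h y / φ y - w y) := by field_simp [(hφpos y).ne']
    rw [h1, abs_mul]
    refine mul_le_mul (hΦ y) ?_ (abs_nonneg _) hΦ0
    rw [abs_sub_comm]; exact (hwε y).le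
  have hφwc : Continuous fun y => φ y * w y := hφc.mul hwc
  have e1 : ∫ x, (∫ y, h y ∂(κ t x)) * ρ x ∂π =
      (∫ x, (∫ y, φ y * w y ∂(κ t x)) * ρ x ∂π) + ∫ x, (∫ y, (h y - φ y * w y) ∂(κ t x)) * ρ x ∂π := by
    rw [← hm_add t hφwc hdc]
    exact integral_congr_ae (Eventually.of_forall fun x => by simp only [add_sub_cancel])
  have e2 : ∫ x, h x * ρ x ∂π = (∫ x, φ x * w x * ρ x ∂π) + ∫ x, (h x - φ x * w x) * ρ x ∂π := by
    rw [← hm₀_add hφwc hdc]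
    exact integral_congr_ae (Eventually.of_forall fun x => by simp only [add_sub_cancel])
  rw [e1, e2, hEq w hw t]
  have h3 := hm_bd t hdc hdb
  have h4 := hm₀_bd hdc hdb
  have hkey : Z * (Φ * (δ / (2 * (Z * Φ + 1)))) + Z * (Φ * (δ / (2 * (Z * Φ + 1)))) ≤ δ := by
    rw [← two_mul]
    have : 2 * (Z * (Φ * (δ / (2 * (Z * Φ + 1))))) = δ * (Z * Φ / (Z * Φ + 1)) := by
      field_simp
    rw [this]
    have hfrac : Z * Φ / (Z * Φ + 1) ≤ 1 := by
      rw [div_le_one hZΦ]; linarith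
    calc δ * (Z * Φ / (Z * Φ + 1)) ≤ δ * 1 := mul_le_mul_of_nonneg_left hfrac hδ.le
      _ = δ := mul_one _
  calc |(∫ x, φ x * w x * ρ x ∂π) + (∫ x, (∫ y, (h y - φ y * w y) ∂(κ t x)) * ρ x ∂π) -
        ((∫ x, φ x * w x * ρ x ∂π) + ∫ x, (h x - φ x * w x) * ρ x ∂π)|
      = |(∫ x, (∫ y, (h y - φ y * w y) ∂(κ t x)) * ρ x ∂π) - ∫ x, (h x - φ x * w x) * ρ x ∂π| := by
        congr 1; ring
    _ ≤ |∫ x, (∫ y, (h y - φ y * w y) ∂(κ t x)) * ρ x ∂π| + |∫ x, (h x - φ x * w x) * ρ x ∂π| := abs_sub _ _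
    _ ≤ Z * (Φ * (δ / (2 * (Z * Φ + 1)))) + Z * (Φ * (δ / (2 * (Z * Φ + 1)))) := add_le_add h3 h4
    _ ≤ 0 + δ := by rw [zero_add]; exact hkey

end Summit.QuantumFields.YangMills.Theorems.ColdStartUniversality

end
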